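import Summits.CriticalPhenomena.PercolationContinuityZ3.Theorems.PercNearOneGluingNoHeavyLowerTailSetPortDomination
import Summits.CriticalPhenomena.PercolationContinuityZ3.Theorems.PercNearOneGluingNoHeavyLowerTailCILAveragedPortDomination
import HarnessLib

/-!
# `NoHeavyLowerTail` (stmt-CriticalPhenomena-4575) — AVERAGED glued port domination for a relay-neighboured Steiner SET

Support file (prover `prim-hp-6`, hull-port cell, observer-set / OES technique; `--supports stmt-CriticalPhenomena-4575`).
No definitions, no named facts, no sorries.

Notation (`μ_w = prodBernoulli w` on `Fin n`, relays `A`, level `j`): `U` a vertex set disjoint from `A`,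
`π(U) = {z ∈ A : z ↔ some x ∈ U}`, `bad_w(U) = μ_w{1 ≤ |π(U)| ≤ j}`, glued lightness
`J_w(U, y) = μ_w(y ↮ U, |π(y)| ≤ j) + μ_w(y ↔ U, |π(U)| ≤ j)` (the lightness of `y` after contracting `U` to a point), and the
set-champion-stability inequality `CS_w(U, c) : μ_w(c ↮ U, 1 ≤ |π(U)| ≤ j) ≤ μ_w(c ↮ U, |π(c)| ≤ j)`
(`Theorems.bad_le_glued_iff_setCS`).  `U` is RELAY-NEIGHBOURED with ports `p 0, …, p (d−1)` (injective, relays) if every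
positive pair from `U` to its outside ends at some `p l`.  The set first-open-port events are
`F^U_l = {some pair x–p l (x ∈ U) is open, every pair x–p m (x ∈ U, m < l) is closed}`, and `w^{(l)}` denotes `w` with the
pairs `x–p i`, `x ∈ U`, `i > l`, switched off.

* `SetPort.setBad_le_firstOpenSum` — **transport of prim-lf-3's averaged port domination
  (`AveragedPort.bad_le_firstOpenSum`) to an observer SET:** if the enumeration is reverse-greedy for the GLUED lightness
  (`J_{w^{(l)}}(U, p l) ≤ J_{w^{(l)}}(U, p m)` for `m ≤ l`), then `bad_w(U) ≤ Σ_l μ_w(F^U_l) · J_w(U, p l)`.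
  Proof: under the member-merge weights `w♯` of `SetPort.real_eq_of_merged` (all members merged into an anchor `u₁`)
  `bad_w(U) = bad_{w♯}(u₁)`, `J_w(U, y) = I_{w♯}(y)`, `μ_w(F^U_l) = μ_{w♯}(F_l)`, and `(w^{(l)})♯ = (w♯)^{(l)}`, so the
  single-observer theorem applies to `u₁` under `w♯`.
* `SetPort.setCS_of_averagedGluedDomination` — hence `CS_w(U, c)` for every `c ∈ A` with
  `Σ_l μ_w(F^U_l) · J_w(U, p l) ≤ J_w(U, c)` (AVERAGED glued domination, "AGD").  This weakens the hypothesis of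
  `SetPort.setCS_of_gluedPortDomination` (domination of EVERY port, known to fail in rare light instances, crux evidence
  HP6-MEMO2 §H) to domination of the first-open-port AVERAGE, which has total weight `μ(some coin open) < 1`.
  Seat census (NOTES gen-2 R2): for `c` a champion of the split graph and `U` light, AGD holds in ≈2.2·10⁴ exact instances
  (n ≤ 8, three generators incl. the near-pendant regime that kills every-port domination) and light-constrained adversarial
  climbs reach sup 0⁻ only at the all-glued corner; without lightness it fails (prim-lf-3 LF3-APSTAR §4).  So this is a
  CONDITIONAL reduction whose hypothesis is census-clean, not a theorem of the wall.
-/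

noncomputable section

namespace Summit.CriticalPhenomena.PercolationContinuityZ3.Theorems

open MeasureTheory Set Literature.Probability.LatticeModels Literature.Probability.Percolation
open scoped Classical BigOperators

variable {n : ℕ}

namespace SetPort

/-! ### The set first-open-port events under the member merge -/

/-- The set first-open-port event `F^U_l` is `U`-stable (it only reads which outside vertices carry an open pair into `U`).
[folklore] -/
theorem uStable_firstOpen (U : Finset (Fin n)) {d : ℕ} (p : Fin d → Fin n) (hpU : ∀ l, p l ∉ U) (l : Fin d) :
    ∀ ξ ξ' : BondConfig (Fin n),
      ((∀ e : Sym2 (Fin n), (∀ u ∈ U, u ∉ e) → (e ∈ ξ ↔ e ∈ ξ')) ∧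
        (∀ v : Fin n, v ∉ U → ((∃ x ∈ U, s(x, v) ∈ ξ) ↔ (∃ x ∈ U, s(x, v) ∈ ξ')))) →
      (ξ ∈ {ω : BondConfig (Fin n) | (∃ x ∈ U, s(x, p l) ∈ ω) ∧ ∀ m, m < l → ∀ x ∈ U, s(x, p m) ∉ ω} ↔
        ξ' ∈ {ω : BondConfig (Fin n) | (∃ x ∈ U, s(x, p l) ∈ ω) ∧ ∀ m, m < l → ∀ x ∈ U, s(x, p m) ∉ ω}) := by
  intro ξ ξ' h
  simp only [mem_setOf_eq]
  have h1 := h.2 (p l) (hpU l)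
  have h2 : ∀ m : Fin d, (∀ x ∈ U, s(x, p m) ∉ ξ) ↔ (∀ x ∈ U, s(x, p m) ∉ ξ') := by
    intro m
    have hm := h.2 (p m) (hpU m)
    constructor
    · intro hall x hx hx'; exact (not_exists.1 (mt hm.2 (not_exists.2 fun y => not_and.2 fun hy => hall y hy))) x ⟨hx, hx'⟩
    · intro hall x hx hx'; exact (not_exists.1 (mt hm.1 (not_exists.2 fun y => not_and.2 fun hy => hall y hy))) x ⟨hx, hx'⟩
  rw [h1]
  constructor
  · rintro ⟨ha, hb⟩; exact ⟨ha, fun m hm => (h2 m).1 (hb m hm)⟩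
  · rintro ⟨ha, hb⟩; exact ⟨ha, fun m hm => (h2 m).2 (hb m hm)⟩

/-- On the support of the merged weights, "some member has an open pair to `v ∉ U`" iff "the anchor's pair to `v` is
open". [folklore] -/
theorem exists_open_iff_anchor (U : Finset (Fin n)) {u₁ : Fin n} (hu₁ : u₁ ∈ U) {ω : BondConfig (Fin n)}
    (hω : ∀ e ∈ ω, (∃ u ∈ U, u ∈ e) → ∃ v : Fin n, v ∉ U ∧ e = s(u₁, v)) {v : Fin n} (hv : v ∉ U) :
    (∃ x ∈ U, s(x, v) ∈ ω) ↔ s(u₁, v) ∈ ω := by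
  refine ⟨fun ⟨x, hx, hxv⟩ => ?_, fun h => ⟨u₁, hu₁, h⟩⟩
  obtain ⟨v', hv', he⟩ := hω _ hxv ⟨x, hx, Sym2.mem_mk_left x v⟩
  rcases Sym2.eq_iff.1 he with ⟨hx1, hvv⟩ | ⟨hxv', hvu⟩
  · rw [hx1] at hxv; exact hxv
  · exact absurd (hvu ▸ hu₁) hv

/-- `μ_w(F^U_l) = μ_{w♯}(F_l)`: the set first-open-port event of `U` under `w` has the probability of the anchor's
first-open-port event under the merged weights. [folklore] -/
theorem real_firstOpen_eq_anchor (w wm : Sym2 (Fin n) → unitInterval) (U : Finset (Fin n)) {u₁ : Fin n}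
    (hu₁ : u₁ ∈ U) {d : ℕ} (p : Fin d → Fin n) (hpU : ∀ l, p l ∉ U) (l : Fin d)
    (hoff : ∀ e : Sym2 (Fin n), (∀ u ∈ U, u ∉ e) → wm e = w e)
    (hzero : ∀ e : Sym2 (Fin n), (∃ u ∈ U, u ∈ e) → (¬ ∃ v : Fin n, v ∉ U ∧ e = s(u₁, v)) → wm e = 0)
    (hcoin : ∀ v : Fin n, v ∉ U → (1 - (wm s(u₁, v) : ℝ)) = ∏ x ∈ U, (1 - (w s(x, v) : ℝ))) :
    (prodBernoulli w).real {ω : BondConfig (Fin n) | (∃ x ∈ U, s(x, p l) ∈ ω) ∧ ∀ m, m < l → ∀ x ∈ U, s(x, p m) ∉ ω} =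
      (prodBernoulli wm).real {ω : BondConfig (Fin n) | s(u₁, p l) ∈ ω ∧ ∀ m, m < l → s(u₁, p m) ∉ ω} := by
  rw [real_eq_of_merged w wm U hu₁ (uStable_firstOpen U p hpU l) hoff hzero hcoin,
    ← CutObserver.measureReal_inter_support wm {ω : BondConfig (Fin n) |
        (∃ x ∈ U, s(x, p l) ∈ ω) ∧ ∀ m, m < l → ∀ x ∈ U, s(x, p m) ∉ ω},
    ← CutObserver.measureReal_inter_support wm {ω : BondConfig (Fin n) |
        s(u₁, p l) ∈ ω ∧ ∀ m, m < l → s(u₁, p m) ∉ ω}]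
  congr 1
  ext ω
  simp only [mem_inter_iff, mem_setOf_eq]
  constructor
  · rintro ⟨⟨ha, hb⟩, hω⟩
    have key := fun v (hv : v ∉ U) => exists_open_iff_anchor U hu₁ (anchor_of_support wm U u₁ hzero hω) hv
    exact ⟨⟨(key _ (hpU l)).1 ha, fun m hm h1 => hb m hm u₁ hu₁ h1⟩, hω⟩
  · rintro ⟨⟨ha, hb⟩, hω⟩
    have key := fun v (hv : v ∉ U) => exists_open_iff_anchor U hu₁ (anchor_of_support wm U u₁ hzero hω) hv
    exact ⟨⟨⟨u₁, hu₁, ha⟩, fun m hm x hx h1 => hb m hm ((key _ (hpU m)).1 ⟨x, hx, h1⟩)⟩, hω⟩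

/-- Switching off the pairs from `U` to the ports `p i`, `i > l`, commutes with the member merge: the weights
`(w♯)^{(l)}` are merged weights of `w^{(l)}`. [folklore] -/
theorem merged_del (w wm : Sym2 (Fin n) → unitInterval) (U : Finset (Fin n)) {u₁ : Fin n} (hu₁ : u₁ ∈ U)
    {d : ℕ} (p : Fin d → Fin n) (l : Fin d)
    (hoff : ∀ e : Sym2 (Fin n), (∀ u ∈ U, u ∉ e) → wm e = w e)
    (hzero : ∀ e : Sym2 (Fin n), (∃ u ∈ U, u ∈ e) → (¬ ∃ v : Fin n, v ∉ U ∧ e = s(u₁, v)) → wm e = 0)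
    (hcoin : ∀ v : Fin n, v ∉ U → (1 - (wm s(u₁, v) : ℝ)) = ∏ x ∈ U, (1 - (w s(x, v) : ℝ))) :
    (∀ e : Sym2 (Fin n), (∀ u ∈ U, u ∉ e) →
        (fun e => if (∃ i : Fin d, l < i ∧ e = s(u₁, p i)) then (0 : unitInterval) else wm e) e =
          (fun e => if (∃ i : Fin d, l < i ∧ ∃ x ∈ U, e = s(x, p i)) then (0 : unitInterval) else w e) e) ∧
      (∀ e : Sym2 (Fin n), (∃ u ∈ U, u ∈ e) → (¬ ∃ v : Fin n, v ∉ U ∧ e = s(u₁, v)) →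
        (fun e => if (∃ i : Fin d, l < i ∧ e = s(u₁, p i)) then (0 : unitInterval) else wm e) e = 0) ∧
      (∀ v : Fin n, v ∉ U →
        (1 - ((fun e => if (∃ i : Fin d, l < i ∧ e = s(u₁, p i)) then (0 : unitInterval) else wm e) s(u₁, v) : ℝ)) =
          ∏ x ∈ U, (1 - ((fun e => if (∃ i : Fin d, l < i ∧ ∃ x ∈ U, e = s(x, p i)) then (0 : unitInterval) else w e)
            s(x, v) : ℝ))) := by
  refine ⟨fun e he => ?_, fun e he hne => ?_, fun v hv => ?_⟩
  · have h1 : ¬ (∃ i : Fin d, l < i ∧ e = s(u₁, p i)) := by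
      rintro ⟨i, -, rfl⟩; exact he u₁ hu₁ (Sym2.mem_mk_left _ _)
    have h2 : ¬ (∃ i : Fin d, l < i ∧ ∃ x ∈ U, e = s(x, p i)) := by
      rintro ⟨i, -, x, hx, rfl⟩; exact he x hx (Sym2.mem_mk_left _ _)
    simp only [h1, h2, if_false]; exact hoff e he
  · dsimp only
    split_ifs
    · rfl
    · exact hzero e he hne
  · by_cases hvi : ∃ i : Fin d, l < i ∧ v = p i
    · obtain ⟨i, hi, rfl⟩ := hvi
      have h1 : (∃ i' : Fin d, l < i' ∧ s(u₁, p i) = s(u₁, p i')) := ⟨i, hi, rfl⟩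
      have hprod : ∀ x ∈ U, (1 - ((fun e => if (∃ i : Fin d, l < i ∧ ∃ x ∈ U, e = s(x, p i))
          then (0 : unitInterval) else w e) s(x, p i) : ℝ)) = 1 := by
        intro x hx
        have h2 : (∃ i' : Fin d, l < i' ∧ ∃ x' ∈ U, s(x, p i) = s(x', p i')) := ⟨i, hi, x, hx, rfl⟩
        simp only [if_pos h2, Set.Icc.coe_zero, sub_zero]
      rw [Finset.prod_eq_one hprod]
      simp only [if_pos h1, Set.Icc.coe_zero, sub_zero]
    · have h1 : ¬ (∃ i' : Fin d, l < i' ∧ s(u₁, v) = s(u₁, p i')) := by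
        rintro ⟨i', hi', he⟩
        rcases Sym2.eq_iff.1 he with ⟨-, h⟩ | ⟨h, h'⟩
        · exact hvi ⟨i', hi', h⟩
        · exact hv (h' ▸ hu₁)
      have e1 : ((fun e => if (∃ i : Fin d, l < i ∧ e = s(u₁, p i)) then (0 : unitInterval) else wm e) s(u₁, v) : ℝ) =
          (wm s(u₁, v) : ℝ) := by simp only [if_neg h1]
      rw [e1, hcoin v hv]
      refine Finset.prod_congr rfl fun x hx => ?_
      have h2 : ¬ (∃ i' : Fin d, l < i' ∧ ∃ x' ∈ U, s(x, v) = s(x', p i')) := by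
        rintro ⟨i', hi', x', hx', he⟩
        rcases Sym2.eq_iff.1 he with ⟨-, h⟩ | ⟨h, h'⟩
        · exact hvi ⟨i', hi', h⟩
        · exact hv (h' ▸ hx')
      simp only [if_neg h2]

/-! ### Averaged glued port domination -/

/-- **Averaged port domination for an observer SET** (transport of `AveragedPort.bad_le_firstOpenSum`).  Let `U` be
disjoint from `A` and relay-neighboured with ports `p 0, …, p (d−1) ∈ A` (`p` injective; every positive pair from `U`
to its outside ends at some `p l`), enumerated REVERSE-GREEDILY for the glued lightness: for `m ≤ l`,
`J_{w^{(l)}}(U, p l) ≤ J_{w^{(l)}}(U, p m)`, where `w^{(l)}` is `w` with the pairs `x–p i` (`x ∈ U`, `i > l`) switched off.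
Then `bad_w(U) ≤ Σ_l μ_w(F^U_l) · J_w(U, p l)`, `F^U_l` = "some pair from `U` to `p l` is open and every pair from `U`
to an earlier port is closed".
[cite: VandenbergHaggstromKahn2005, Thm. 1.5 (p. 7) — setting; the inequality is prim-lf-3's `AveragedPort.bad_le_firstOpenSum`
applied to the anchor of the member merge `SetPort.real_eq_of_merged`] -/
theorem setBad_le_firstOpenSum (w : Sym2 (Fin n) → unitInterval) (A U : Finset (Fin n)) (hUA : Disjoint U A)
    (j : ℕ) {d : ℕ} (p : Fin d → Fin n) (hp : Function.Injective p) (hpA : ∀ l, p l ∈ A)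
    (hobs : ∀ x ∈ U, ∀ v : Fin n, v ∉ U → w s(x, v) ≠ 0 → ∃ l, v = p l)
    (hRG : ∀ l m : Fin d, m ≤ l →
      (prodBernoulli (fun e => if (∃ i : Fin d, l < i ∧ ∃ x ∈ U, e = s(x, p i)) then (0 : unitInterval) else w e)).real
          {ω : BondConfig (Fin n) | (∀ x ∈ U, ω ∉ openConn (p l) x) ∧
            (A.filter fun z => ω ∈ openConn (p l) z).card ≤ j} +
        (prodBernoulli (fun e => if (∃ i : Fin d, l < i ∧ ∃ x ∈ U, e = s(x, p i)) then (0 : unitInterval) else w e)).real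
          {ω : BondConfig (Fin n) | (∃ x ∈ U, ω ∈ openConn (p l) x) ∧
            (A.filter fun z => ∃ x ∈ U, ω ∈ openConn x z).card ≤ j} ≤
      (prodBernoulli (fun e => if (∃ i : Fin d, l < i ∧ ∃ x ∈ U, e = s(x, p i)) then (0 : unitInterval) else w e)).real
          {ω : BondConfig (Fin n) | (∀ x ∈ U, ω ∉ openConn (p m) x) ∧
            (A.filter fun z => ω ∈ openConn (p m) z).card ≤ j} +
        (prodBernoulli (fun e => if (∃ i : Fin d, l < i ∧ ∃ x ∈ U, e = s(x, p i)) then (0 : unitInterval) else w e)).real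
          {ω : BondConfig (Fin n) | (∃ x ∈ U, ω ∈ openConn (p m) x) ∧
            (A.filter fun z => ∃ x ∈ U, ω ∈ openConn x z).card ≤ j}) :
    (prodBernoulli w).real {ω : BondConfig (Fin n) |
        1 ≤ (A.filter fun z => ∃ x ∈ U, ω ∈ openConn x z).card ∧
        (A.filter fun z => ∃ x ∈ U, ω ∈ openConn x z).card ≤ j} ≤
      ∑ l : Fin d, (prodBernoulli w).real {ω : BondConfig (Fin n) |
          (∃ x ∈ U, s(x, p l) ∈ ω) ∧ ∀ m, m < l → ∀ x ∈ U, s(x, p m) ∉ ω} *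
        ((prodBernoulli w).real {ω : BondConfig (Fin n) | (∀ x ∈ U, ω ∉ openConn (p l) x) ∧
            (A.filter fun z => ω ∈ openConn (p l) z).card ≤ j} +
          (prodBernoulli w).real {ω : BondConfig (Fin n) | (∃ x ∈ U, ω ∈ openConn (p l) x) ∧
            (A.filter fun z => ∃ x ∈ U, ω ∈ openConn x z).card ≤ j}) := by
  have hpU : ∀ l, p l ∉ U := fun l h => Finset.disjoint_left.1 hUA h (hpA l)
  -- the empty set is trivial
  rcases U.eq_empty_or_nonempty with hU | ⟨u₁, hu₁⟩
  · subst hU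
    have h0 : (prodBernoulli w).real {ω : BondConfig (Fin n) |
        1 ≤ ((A.filter fun z => ∃ x ∈ (∅ : Finset (Fin n)), ω ∈ openConn x z).card) ∧
        (A.filter fun z => ∃ x ∈ (∅ : Finset (Fin n)), ω ∈ openConn x z).card ≤ j} = 0 := by
      have : {ω : BondConfig (Fin n) |
          1 ≤ ((A.filter fun z => ∃ x ∈ (∅ : Finset (Fin n)), ω ∈ openConn x z).card) ∧
          (A.filter fun z => ∃ x ∈ (∅ : Finset (Fin n)), ω ∈ openConn x z).card ≤ j} = ∅ := by
        refine Set.eq_empty_iff_forall_notMem.2 fun ω h => ?_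
        have hc : (A.filter fun z => ∃ x ∈ (∅ : Finset (Fin n)), ω ∈ openConn x z).card = 0 := by
          rw [Finset.card_eq_zero, Finset.filter_eq_empty_iff]
          rintro z - ⟨x, hx, -⟩; exact absurd hx (Finset.notMem_empty x)
        have h1 := h.1
        omega
      rw [this, measureReal_empty]
    rw [h0]
    exact Finset.sum_nonneg fun l _ => mul_nonneg measureReal_nonneg (add_nonneg measureReal_nonneg measureReal_nonneg)
  obtain ⟨wm, hoff, hzero, hcoin⟩ := exists_merged w U hu₁
  have hu₁A : u₁ ∉ A := fun h => Finset.disjoint_left.1 hUA hu₁ h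
  -- positive neighbours of the anchor under `wm` are ports
  have hobs' : ∀ v, wm s(u₁, v) ≠ 0 → ∃ l, v = p l := by
    intro v hv
    have hvU : v ∉ U := by
      intro hvU
      exact hv (hzero _ ⟨u₁, hu₁, Sym2.mem_mk_left u₁ v⟩ (by
        rintro ⟨v', hv', he⟩
        rcases Sym2.eq_iff.1 he with ⟨-, h⟩ | ⟨h, -⟩
        · exact hv' (h ▸ hvU)
        · exact hv' (h ▸ hu₁)))
    have hprod : ∏ x ∈ U, (1 - (w s(x, v) : ℝ)) ≠ 1 := by
      intro h1
      have := hcoin v hvU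
      rw [h1] at this
      have h0 : (wm s(u₁, v) : ℝ) = 0 := by linarith
      exact hv (Subtype.ext h0)
    have : ∃ x ∈ U, w s(x, v) ≠ 0 := by
      by_contra hall
      refine hprod (Finset.prod_eq_one fun x hx => ?_)
      have h0 : w s(x, v) = 0 := by by_contra h; exact hall ⟨x, hx, h⟩
      rw [h0]; simp
    obtain ⟨x, hx, hxv⟩ := this
    exact hobs x hx v hvU hxv
  -- the reverse-greedy hypothesis under `wm`
  have hRG' : ∀ l m : Fin d, m ≤ l →
      (prodBernoulli (fun e => if (∃ i : Fin d, l < i ∧ e = s(u₁, p i)) then (0 : unitInterval) else wm e)).real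
          {ω : BondConfig (Fin n) | (A.filter fun z => ω ∈ openConn (p l) z).card ≤ j} ≤
        (prodBernoulli (fun e => if (∃ i : Fin d, l < i ∧ e = s(u₁, p i)) then (0 : unitInterval) else wm e)).real
          {ω : BondConfig (Fin n) | (A.filter fun z => ω ∈ openConn (p m) z).card ≤ j} := by
    intro l m hml
    obtain ⟨hoff', hzero', hcoin'⟩ := merged_del w wm U hu₁ p l hoff hzero hcoin
    rw [← glued_eq_lightness_anchor _ _ A U hUA hu₁ (hpU l) j hoff' hzero' hcoin',
      ← glued_eq_lightness_anchor _ _ A U hUA hu₁ (hpU m) j hoff' hzero' hcoin']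
    exact hRG l m hml
  have key := AveragedPort.bad_le_firstOpenSum d wm A u₁ j p hp hpA hu₁A hobs' hRG'
  rw [real_bad_eq_anchor w wm A U hUA hu₁ j hoff hzero hcoin]
  refine key.trans (le_of_eq (Finset.sum_congr rfl fun l _ => ?_))
  rw [real_firstOpen_eq_anchor w wm U hu₁ p hpU l hoff hzero hcoin,
    glued_eq_lightness_anchor w wm A U hUA hu₁ (hpU l) j hoff hzero hcoin]

/-- **Set-champion stability from AVERAGED glued port domination (AGD).**  Under the hypotheses of
`setBad_le_firstOpenSum`, every `c ∈ A` whose glued lightness dominates the first-open-port average,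
`Σ_l μ_w(F^U_l) · J_w(U, p l) ≤ J_w(U, c)`, satisfies `CS_w(U, c)`:
`μ_w(c ↮ U, 1 ≤ |π(U)| ≤ j) ≤ μ_w(c ↮ U, |π(c)| ≤ j)`.
[cite: VandenbergHaggstromKahn2005, Thm. 1.5 (p. 7) — via `setBad_le_firstOpenSum` and `Theorems.bad_le_glued_iff_setCS`] -/
theorem setCS_of_averagedGluedDomination (w : Sym2 (Fin n) → unitInterval) (A U : Finset (Fin n))
    (hUA : Disjoint U A) (c : Fin n) (hcA : c ∈ A) (j : ℕ) {d : ℕ} (p : Fin d → Fin n)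
    (hp : Function.Injective p) (hpA : ∀ l, p l ∈ A)
    (hobs : ∀ x ∈ U, ∀ v : Fin n, v ∉ U → w s(x, v) ≠ 0 → ∃ l, v = p l)
    (hRG : ∀ l m : Fin d, m ≤ l →
      (prodBernoulli (fun e => if (∃ i : Fin d, l < i ∧ ∃ x ∈ U, e = s(x, p i)) then (0 : unitInterval) else w e)).real
          {ω : BondConfig (Fin n) | (∀ x ∈ U, ω ∉ openConn (p l) x) ∧
            (A.filter fun z => ω ∈ openConn (p l) z).card ≤ j} +
        (prodBernoulli (fun e => if (∃ i : Fin d, l < i ∧ ∃ x ∈ U, e = s(x, p i)) then (0 : unitInterval) else w e)).real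
          {ω : BondConfig (Fin n) | (∃ x ∈ U, ω ∈ openConn (p l) x) ∧
            (A.filter fun z => ∃ x ∈ U, ω ∈ openConn x z).card ≤ j} ≤
      (prodBernoulli (fun e => if (∃ i : Fin d, l < i ∧ ∃ x ∈ U, e = s(x, p i)) then (0 : unitInterval) else w e)).real
          {ω : BondConfig (Fin n) | (∀ x ∈ U, ω ∉ openConn (p m) x) ∧
            (A.filter fun z => ω ∈ openConn (p m) z).card ≤ j} +
        (prodBernoulli (fun e => if (∃ i : Fin d, l < i ∧ ∃ x ∈ U, e = s(x, p i)) then (0 : unitInterval) else w e)).real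
          {ω : BondConfig (Fin n) | (∃ x ∈ U, ω ∈ openConn (p m) x) ∧
            (A.filter fun z => ∃ x ∈ U, ω ∈ openConn x z).card ≤ j})
    (hAGD : ∑ l : Fin d, (prodBernoulli w).real {ω : BondConfig (Fin n) |
          (∃ x ∈ U, s(x, p l) ∈ ω) ∧ ∀ m, m < l → ∀ x ∈ U, s(x, p m) ∉ ω} *
        ((prodBernoulli w).real {ω : BondConfig (Fin n) | (∀ x ∈ U, ω ∉ openConn (p l) x) ∧
            (A.filter fun z => ω ∈ openConn (p l) z).card ≤ j} +
          (prodBernoulli w).real {ω : BondConfig (Fin n) | (∃ x ∈ U, ω ∈ openConn (p l) x) ∧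
            (A.filter fun z => ∃ x ∈ U, ω ∈ openConn x z).card ≤ j}) ≤
      (prodBernoulli w).real {ω : BondConfig (Fin n) | (∀ x ∈ U, ω ∉ openConn c x) ∧
          (A.filter fun z => ω ∈ openConn c z).card ≤ j} +
        (prodBernoulli w).real {ω : BondConfig (Fin n) | (∃ x ∈ U, ω ∈ openConn c x) ∧
          (A.filter fun z => ∃ x ∈ U, ω ∈ openConn x z).card ≤ j}) :
    (prodBernoulli w).real {ω : BondConfig (Fin n) | (∀ x ∈ U, ω ∉ openConn c x) ∧
        1 ≤ (A.filter fun z => ∃ x ∈ U, ω ∈ openConn x z).card ∧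
        (A.filter fun z => ∃ x ∈ U, ω ∈ openConn x z).card ≤ j} ≤
      (prodBernoulli w).real {ω : BondConfig (Fin n) | (∀ x ∈ U, ω ∉ openConn c x) ∧
        (A.filter fun z => ω ∈ openConn c z).card ≤ j} :=
  (CutObserver.bad_le_glued_iff_setCS w A U c j hcA).2
    ((setBad_le_firstOpenSum w A U hUA j p hp hpA hobs hRG).trans hAGD)

end SetPort

end Summit.CriticalPhenomena.PercolationContinuityZ3.Theorems

end
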